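import Summits.MatrixMultiplication.MatrixMultiplication.Theorems.NilpotentLieHostsUnitriangularCostShapeModelTrunc

/-!
# `UnitriangularCostShape` — Product model, part 3: the action `π_T` on `W_T`, base change, the universal slices

Crux `stmt-MatrixMultiplication-7724` (`NilpotentLieHosts.UnitriangularCostShape`), line `registered`
(`Cruxes/UnitriangularCostShape/Lines/birth.lean`), stub `stub_productModel` (the Weyl-type product model of
`U(u_d)/I^(s+1)` over the truncated Casimir algebra, `b = k = ⌊d/2⌋`).  Helper vocabulary and lemmas, namespace
`…Theorems.UnitriangularCostShape.ProductModel`.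

Truncated exponentials, the exponential factor `Eprod`, the action `π_T(c) w = exp(n_c) · σ_c(w)` with its group
law `π_T(c) π_T(c') = π_T(c c')` for upper unitriangular `c, c'`, coefficient functionals `coeffQ`, base change along
ring maps, and the universal (generic-matrix) slices `Slice K α γ ∈ ℂ[x_{ij}]` with the specialisation lemma
`eval_Slice`; joint supports `JSupp` and their calculus.
-/

set_option linter.dupNamespace false

noncomputable section

namespace Summit.MatrixMultiplication.MatrixMultiplication.Theorems.UnitriangularCostShape.ProductModel

open MvPolynomial
open scoped BigOperators

variable {d : ℕ} {R : Type*} [CommRing R] [Algebra ℚ R]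

/-- Truncated exponential series `Σ_{k<K} y^k / k!`. -/
def expK (K : ℕ) (y : MvPolynomial (Var d) R) : MvPolynomial (Var d) R :=
  ∑ k ∈ Finset.range K, (k.factorial : ℚ)⁻¹ • y ^ k

/-- Product form of the exponential factor: `E_c = ∏_u expK (c_u • X u)`. -/
def Eprod (K : ℕ) (c : Matrix (Fin d) (Fin d) R) : MvPolynomial (Var d) R :=
  ∏ u : Var d, expK K (C (c u.row u.col) * X u)

/-- In a commutative `ℚ`-algebra, `exp` of a finite sum of nilpotents is the product of the `exp`s. -/
theorem exp_sum_eq_prod {A : Type*} [CommRing A] [Algebra ℚ A] {ι : Type*} (s : Finset ι) (a : ι → A)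
    (h : ∀ i ∈ s, IsNilpotent (a i)) :
    IsNilpotent.exp (∑ i ∈ s, a i) = ∏ i ∈ s, IsNilpotent.exp (a i) := by
  classical
  induction s using Finset.induction_on with
  | empty => simp
  | insert j s hj ih =>
    rw [Finset.sum_insert hj, Finset.prod_insert hj,
      IsNilpotent.exp_add_of_commute (Commute.all _ _) (h j (Finset.mem_insert_self j s))
        (isNilpotent_sum fun i hi => h i (Finset.mem_insert_of_mem hi)),
      ih fun i hi => h i (Finset.mem_insert_of_mem hi)]

/-- In `W_T`, `exp` of an element of positive weight is its truncated exponential series. -/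
theorem exp_mk_eq_mk_expK {T K : ℕ} (hK : T + 1 ≤ K) {f : MvPolynomial (Var d) R} (hf : WtGe 1 f) :
    IsNilpotent.exp (Ideal.Quotient.mk (truncIdeal d R T) f) =
      Ideal.Quotient.mk (truncIdeal d R T) (expK K f) := by
  rw [IsNilpotent.exp_eq_sum (pow_mk_eq_zero_of_wtGe hf hK)]
  unfold expK
  rw [map_sum]
  refine Finset.sum_congr rfl fun k _ => ?_
  rw [map_rat_smul, map_pow]

/-- `exp (n_c) = E_c` in the truncated module (for `K > T`). -/
theorem exp_mk_nvec {T K : ℕ} (hK : T + 1 ≤ K) (c : Matrix (Fin d) (Fin d) R) :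
    IsNilpotent.exp (Ideal.Quotient.mk (truncIdeal d R T) (nvec c)) =
      Ideal.Quotient.mk (truncIdeal d R T) (Eprod K c) := by
  unfold nvec Eprod
  rw [map_sum, map_prod, exp_sum_eq_prod]
  · refine Finset.prod_congr rfl fun u _ => ?_
    exact exp_mk_eq_mk_expK hK (((wtGe_X u).C_mul _).mono u.one_le_wt)
  · intro u _
    exact isNilpotent_mk_of_wtGe (((wtGe_X u).C_mul _).mono u.one_le_wt)

/-- The action of (the coefficient matrix) `c` on the truncated module:
`π_T(c) w = exp (n_c) · σ_c (w)`. -/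
def piT (T : ℕ) (c : Matrix (Fin d) (Fin d) R) (w : TruncModel d R T) : TruncModel d R T :=
  IsNilpotent.exp (Ideal.Quotient.mk (truncIdeal d R T) (nvec c)) * sigmaQ T c w

/-- `π_T(c)` on representatives, with the product form of the exponential factor. -/
theorem piT_mk {T K : ℕ} (hK : T + 1 ≤ K) (c : Matrix (Fin d) (Fin d) R) (f : MvPolynomial (Var d) R) :
    piT T c (Ideal.Quotient.mk _ f) = Ideal.Quotient.mk _ (Eprod K c * sigma c f) := by
  unfold piT
  rw [exp_mk_nvec hK, sigmaQ_mk, map_mul]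

/-- `π_T(c)` is additive. -/
theorem piT_add (T : ℕ) (c : Matrix (Fin d) (Fin d) R) (w w' : TruncModel d R T) :
    piT T c (w + w') = piT T c w + piT T c w' := by
  unfold piT; rw [map_add, mul_add]

/-- `π_T(c)` is `R`-linear. -/
theorem piT_smul (T : ℕ) (c : Matrix (Fin d) (Fin d) R) (r : R) (w : TruncModel d R T) :
    piT T c (r • w) = r • piT T c w := by
  unfold piT; rw [map_smul, mul_smul_comm]

/-- **Group law** on the truncated module: `π(c) (π(c') w) = π(c c') w` for upper unitriangular
`c, c'`. -/
theorem piT_piT {T : ℕ} {c c' : Matrix (Fin d) (Fin d) R}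
    (hc : ∀ i j : Fin d, j ≤ i → c i j = if i = j then 1 else 0)
    (hc' : ∀ i j : Fin d, j ≤ i → c' i j = if i = j then 1 else 0) (w : TruncModel d R T) :
    piT T c (piT T c' w) = piT T (c * c') w := by
  obtain ⟨f, rfl⟩ := Ideal.Quotient.mk_surjective w
  have h1 : sigmaQ T c (IsNilpotent.exp (Ideal.Quotient.mk (truncIdeal d R T) (nvec c'))) =
      IsNilpotent.exp (Ideal.Quotient.mk (truncIdeal d R T) (sigma c (nvec c'))) := by
    rw [IsNilpotent.map_exp (isNilpotent_mk_of_wtGe (wtGe_nvec c')) (sigmaQ T c), sigmaQ_mk]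
  have h2 : IsNilpotent.exp (Ideal.Quotient.mk (truncIdeal d R T) (nvec c)) *
      IsNilpotent.exp (Ideal.Quotient.mk (truncIdeal d R T) (sigma c (nvec c'))) =
      IsNilpotent.exp (Ideal.Quotient.mk (truncIdeal d R T) (nvec (c * c'))) := by
    rw [← IsNilpotent.exp_add_of_commute (Commute.all _ _) (isNilpotent_mk_of_wtGe (wtGe_nvec c))
        (isNilpotent_mk_of_wtGe ((wtGe_nvec c').sigma c)), ← map_add, ← nvec_mul hc hc']
  unfold piT
  rw [map_mul, h1, sigmaQ_mk, sigmaQ_mk, sigmaQ_mk, sigma_sigma hc hc', ← mul_assoc, h2]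

omit [Algebra ℚ R] in
/-- Corner (central) variables are fixed by every substitution. -/
theorem sigmaX_of_corner (c : Matrix (Fin d) (Fin d) R) (u : Var d)
    (hu : (u.row : ℕ) + u.col + 1 = d) : sigmaX c u = X u := by
  unfold sigmaX
  rw [add_eq_left]
  refine Finset.sum_eq_zero fun u' _ => ?_
  rw [if_neg]
  rintro ⟨h1, h2⟩
  have := u'.le_row_add_col
  rw [h1] at this
  have h3 : (u'.row : ℕ) < u.row := h2
  omega

/-- `π_T(c)` commutes with multiplication by a corner variable. -/
theorem piT_mul_corner (T : ℕ) (c : Matrix (Fin d) (Fin d) R) (u : Var d)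
    (hu : (u.row : ℕ) + u.col + 1 = d) (w : TruncModel d R T) :
    piT T c (Ideal.Quotient.mk _ (X u) * w) = Ideal.Quotient.mk _ (X u) * piT T c w := by
  unfold piT
  rw [map_mul, sigmaQ_mk, sigma_X, sigmaX_of_corner c u hu]
  ring

/-! ### Base change along a ring map -/

variable {S : Type*} [CommRing S] [Algebra ℚ S]

omit [Algebra ℚ R] [Algebra ℚ S] in
/-- Base change of `σ_c (X u)` along a ring map. -/
theorem map_sigmaX (φ : R →+* S) (c : Matrix (Fin d) (Fin d) R) (u : Var d) :
    MvPolynomial.map φ (sigmaX c u) = sigmaX (c.map φ) u := by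
  unfold sigmaX
  simp only [map_add, map_sum, MvPolynomial.map_X]
  congr 1
  refine Finset.sum_congr rfl fun u' _ => ?_
  split_ifs <;> simp

omit [Algebra ℚ R] [Algebra ℚ S] in
/-- Base change of `σ_c` along a ring map. -/
theorem map_sigma (φ : R →+* S) (c : Matrix (Fin d) (Fin d) R) (f : MvPolynomial (Var d) R) :
    MvPolynomial.map φ (sigma c f) = sigma (c.map φ) (MvPolynomial.map φ f) := by
  have : (MvPolynomial.map φ).comp (sigma c).toRingHom =
      (sigma (c.map φ)).toRingHom.comp (MvPolynomial.map φ) := by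
    refine MvPolynomial.ringHom_ext (fun r => ?_) (fun u => ?_)
    · simp
    · simp [map_sigmaX]
  exact RingHom.congr_fun this f

omit [Algebra ℚ R] [Algebra ℚ S] in
/-- Base change of `n_c` along a ring map. -/
theorem map_nvec (φ : R →+* S) (c : Matrix (Fin d) (Fin d) R) :
    MvPolynomial.map φ (nvec c) = nvec (d := d) (c.map φ) := by
  unfold nvec; simp [map_sum]

/-- Base change of the truncated exponential along a ring map. -/
theorem map_expK (φ : R →+* S) (K : ℕ) (y : MvPolynomial (Var d) R) :
    MvPolynomial.map φ (expK K y) = expK K (MvPolynomial.map φ y) := by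
  unfold expK
  simp only [map_sum]
  refine Finset.sum_congr rfl fun k _ => ?_
  rw [map_rat_smul, map_pow]

/-- Base change of the exponential factor along a ring map. -/
theorem map_Eprod (φ : R →+* S) (K : ℕ) (c : Matrix (Fin d) (Fin d) R) :
    MvPolynomial.map φ (Eprod K c) = Eprod K (c.map φ) := by
  unfold Eprod
  rw [map_prod]
  refine Finset.prod_congr rfl fun u _ => ?_
  rw [map_expK]; simp

/-! ### Reading coefficients on the truncated module -/

omit [Algebra ℚ R] in
/-- Coefficients of small weight vanish on the truncation ideal. -/
theorem coeff_eq_zero_of_mem_truncIdeal {T : ℕ} {γ : Var d →₀ ℕ} (hγ : Finsupp.weight Var.wt γ ≤ T)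
    {f : MvPolynomial (Var d) R} (hf : f ∈ truncIdeal d R T) : coeff γ f = 0 := by
  rw [mem_truncIdeal_iff] at hf
  by_contra h
  have := hf γ (by simpa [MvPolynomial.mem_support_iff] using h)
  omega

omit [Algebra ℚ R] in
/-- The coefficient of a monomial of weight `≤ T`, as an `R`-linear functional on `W_T`. -/
def coeffQ (T : ℕ) (γ : Var d →₀ ℕ) (hγ : Finsupp.weight Var.wt γ ≤ T) : TruncModel d R T →ₗ[R] R :=
  (((truncIdeal d R T).restrictScalars R).liftQ (lcoeff R γ) (by
      intro f hf
      rw [LinearMap.mem_ker]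
      exact coeff_eq_zero_of_mem_truncIdeal hγ hf)) ∘ₗ
    (Submodule.Quotient.restrictScalarsEquiv R (truncIdeal d R T)).symm.toLinearMap

omit [Algebra ℚ R] in
/-- The coefficient functional on representatives. -/
@[simp] theorem coeffQ_mk (T : ℕ) (γ : Var d →₀ ℕ) (hγ : Finsupp.weight Var.wt γ ≤ T)
    (f : MvPolynomial (Var d) R) :
    coeffQ T γ hγ (Ideal.Quotient.mk (truncIdeal d R T) f) = coeff γ f := by
  unfold coeffQ
  rw [LinearMap.comp_apply]
  erw [Submodule.Quotient.restrictScalarsEquiv_symm_mk]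
  rw [Submodule.liftQ_apply]
  rfl

open MvPolynomial
open scoped BigOperators Pointwise

variable {d : ℕ}

/-- The coefficient ring of the universal model: polynomials in the matrix entries. -/
abbrev A (d : ℕ) : Type := MvPolynomial (Fin d × Fin d) ℂ

/-- The generic matrix. -/
def Xmat (d : ℕ) : Matrix (Fin d) (Fin d) (A d) := fun i j => X (i, j)

/-- The universal matrix coefficient `U_K(γ, α)`: coefficient of `v^γ` in `E · σ(v^α)` for the generic
matrix, a polynomial in the matrix entries. -/
def Slice (K : ℕ) (α γ : Var d →₀ ℕ) : A d :=
  coeff γ (Eprod K (Xmat d) * sigma (Xmat d) (monomial α 1))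

/-- Specialising the generic matrix at `g` recovers the truncated action: for `K > T` and
`wt γ ≤ T`, `U_K(γ, α)(g) = coeff_γ (π_T(g) [v^α])`. -/
theorem eval_Slice {T K : ℕ} (hK : T + 1 ≤ K) (g : Matrix (Fin d) (Fin d) ℂ) (α γ : Var d →₀ ℕ)
    (hγ : Finsupp.weight Var.wt γ ≤ T) :
    MvPolynomial.eval (fun p : Fin d × Fin d => g p.1 p.2) (Slice K α γ) =
      coeffQ T γ hγ (piT T g (Ideal.Quotient.mk _ (monomial α 1))) := by
  unfold Slice
  have hg : (Xmat d).map (MvPolynomial.eval fun p : Fin d × Fin d => g p.1 p.2) = g := by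
    ext i j; simp [Xmat]
  rw [← MvPolynomial.coeff_map, map_mul, map_Eprod, map_sigma, hg, MvPolynomial.map_monomial,
    map_one, piT_mk hK, coeffQ_mk]

/-! ### Joint supports in `A[Var d]` -/

/-- The joint support of `P ∈ A_d[Var d]`: pairs (`x`-exponent, `v`-exponent) with nonzero coefficient. -/
def JSupp (P : MvPolynomial (Var d) (A d)) : Set ((Fin d × Fin d →₀ ℕ) × (Var d →₀ ℕ)) :=
  {x | x.1 ∈ (P.coeff x.2).support}

/-- Membership in the joint support. -/
theorem mem_jsupp {P : MvPolynomial (Var d) (A d)} {x : (Fin d × Fin d →₀ ℕ) × (Var d →₀ ℕ)} :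
    x ∈ JSupp P ↔ coeff x.1 (coeff x.2 P) ≠ 0 := by
  simp [JSupp, MvPolynomial.mem_support_iff]

/-- The joint support of `0` is empty. -/
theorem jsupp_zero : JSupp (0 : MvPolynomial (Var d) (A d)) = ∅ := by
  ext x; simp [mem_jsupp]

/-- Joint support of a sum. -/
theorem jsupp_add (P Q : MvPolynomial (Var d) (A d)) : JSupp (P + Q) ⊆ JSupp P ∪ JSupp Q := by
  intro x hx
  rw [mem_jsupp, coeff_add, coeff_add] at hx
  by_contra h
  simp only [Set.mem_union, mem_jsupp, not_or, not_not] at h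
  exact hx (by rw [h.1, h.2, add_zero])

/-- Joint support of a finite sum. -/
theorem jsupp_sum {ι : Type*} (s : Finset ι) (f : ι → MvPolynomial (Var d) (A d)) :
    JSupp (∑ i ∈ s, f i) ⊆ ⋃ i ∈ s, JSupp (f i) := by
  classical
  induction s using Finset.induction_on with
  | empty => simp [jsupp_zero]
  | insert i s hi ih =>
    rw [Finset.sum_insert hi]
    refine (jsupp_add _ _).trans ?_
    intro x hx
    rcases hx with h | h
    · exact Set.mem_biUnion (Finset.mem_insert_self i s) h
    · obtain ⟨k, hk, hk'⟩ := Set.mem_iUnion₂.mp (ih h)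
      exact Set.mem_biUnion (Finset.mem_insert_of_mem hk) hk'

/-- Joint support of a product lies in the sum of the joint supports. -/
theorem jsupp_mul (P Q : MvPolynomial (Var d) (A d)) : JSupp (P * Q) ⊆ JSupp P + JSupp Q := by
  classical
  intro x hx
  rw [mem_jsupp, coeff_mul] at hx
  have hx' : x.1 ∈ (∑ y ∈ Finset.HasAntidiagonal.antidiagonal x.2,
      coeff y.1 P * coeff y.2 Q).support := by
    simpa [MvPolynomial.mem_support_iff] using hx
  obtain ⟨y, hy, hy'⟩ := Finset.mem_biUnion.mp (MvPolynomial.support_sum hx')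
  obtain ⟨b1, hb1, b2, hb2, hb⟩ := Finset.mem_add.mp (MvPolynomial.support_mul _ _ hy')
  refine Set.mem_add.mpr ⟨(b1, y.1), hb1, (b2, y.2), hb2, ?_⟩
  rw [Finset.HasAntidiagonal.mem_antidiagonal] at hy
  ext : 1
  · exact hb
  · exact hy

/-- Joint support of a constant (in the `v`-variables). -/
theorem jsupp_C (a : A d) : JSupp (C a : MvPolynomial (Var d) (A d)) ⊆ {x | x.2 = 0 ∧ x.1 ∈ a.support} := by
  classical
  intro x hx
  rw [mem_jsupp, coeff_C] at hx
  by_cases h : 0 = x.2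
  · rw [if_pos h] at hx
    exact ⟨h.symm, MvPolynomial.mem_support_iff.mpr hx⟩
  · rw [if_neg h] at hx; simp at hx

/-- Joint support of a variable. -/
theorem jsupp_X (u : Var d) : JSupp (X u : MvPolynomial (Var d) (A d)) ⊆ {(0, Finsupp.single u 1)} := by
  classical
  intro x hx
  rw [mem_jsupp, coeff_X] at hx
  by_cases h : Finsupp.single u 1 = x.2
  · rw [if_pos h] at hx
    have h1 : x.1 = 0 := by
      by_contra h1
      apply hx
      rw [MvPolynomial.coeff_one, if_neg (Ne.symm h1)]
    simp only [Set.mem_singleton_iff]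
    ext : 1
    · exact h1
    · exact h.symm
  · rw [if_neg h] at hx; simp at hx

/-- Rational scaling does not enlarge the joint support. -/
theorem jsupp_smul (q : ℚ) (P : MvPolynomial (Var d) (A d)) : JSupp (q • P) ⊆ JSupp P := by
  intro x hx
  rw [mem_jsupp] at hx ⊢
  intro h; apply hx
  rw [MvPolynomial.coeff_smul, MvPolynomial.coeff_smul, h, smul_zero]

/-- Products: if the joint supports of `P`, `Q` lie in `S a`, `S b` for an additive family `S`, then
the joint support of `P Q` lies in `S (a + b)`. -/
theorem jsupp_mul_subset {M : Type*} [AddMonoid M] (S : M → Set ((Fin d × Fin d →₀ ℕ) × (Var d →₀ ℕ)))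
    (hS : ∀ a b x y, x ∈ S a → y ∈ S b → x + y ∈ S (a + b))
    {a b : M} {P Q : MvPolynomial (Var d) (A d)} (hP : JSupp P ⊆ S a) (hQ : JSupp Q ⊆ S b) :
    JSupp (P * Q) ⊆ S (a + b) := by
  intro x hx
  obtain ⟨y, hy, z, hz, rfl⟩ := Set.mem_add.mp (jsupp_mul P Q hx)
  exact hS a b y z (hP hy) (hQ hz)

/-- Powers: joint support in an additive family. -/
theorem jsupp_pow_subset {M : Type*} [AddMonoid M] (S : M → Set ((Fin d × Fin d →₀ ℕ) × (Var d →₀ ℕ)))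
    (hS : ∀ a b x y, x ∈ S a → y ∈ S b → x + y ∈ S (a + b)) (h0 : (0 : _ × _) ∈ S 0)
    {a : M} {P : MvPolynomial (Var d) (A d)} (hP : JSupp P ⊆ S a) (n : ℕ) :
    JSupp (P ^ n) ⊆ S (n • a) := by
  induction n with
  | zero =>
    rw [pow_zero, zero_nsmul]
    refine (jsupp_C (1 : A d) |> fun h => ?_)
    intro x hx
    have := jsupp_C (1 : A d) (by simpa using hx)
    obtain ⟨h2, h1⟩ := this
    have h1' : x.1 = 0 := by
      classical
      have := MvPolynomial.support_monomial_subset h1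
      simpa using this
    have : x = 0 := Prod.ext h1' h2
    rw [this]; exact h0
  | succ n ih =>
    rw [pow_succ, succ_nsmul]
    exact jsupp_mul_subset S hS ih hP

/-- Finite products: joint support in an additive family. -/
theorem jsupp_prod_subset {ι M : Type*} [AddCommMonoid M] (s : Finset ι)
    (S : M → Set ((Fin d × Fin d →₀ ℕ) × (Var d →₀ ℕ)))
    (hS : ∀ a b x y, x ∈ S a → y ∈ S b → x + y ∈ S (a + b)) (h0 : (0 : _ × _) ∈ S 0)
    {a : ι → M} {P : ι → MvPolynomial (Var d) (A d)} (hP : ∀ i ∈ s, JSupp (P i) ⊆ S (a i)) :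
    JSupp (∏ i ∈ s, P i) ⊆ S (∑ i ∈ s, a i) := by
  classical
  induction s using Finset.induction_on with
  | empty =>
    rw [Finset.prod_empty, Finset.sum_empty]
    have := jsupp_pow_subset S hS h0 (P := (0 : MvPolynomial (Var d) (A d))) (a := 0)
      (by simp [jsupp_zero]) 0
    simpa using this
  | insert i s hi ih =>
    rw [Finset.prod_insert hi, Finset.sum_insert hi]
    exact jsupp_mul_subset S hS (hP i (Finset.mem_insert_self i s))
      (ih fun k hk => hP k (Finset.mem_insert_of_mem hk))

/-- Finite sums: joint support in a fixed set. -/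
theorem jsupp_sum_subset {ι : Type*} (s : Finset ι) (S : Set ((Fin d × Fin d →₀ ℕ) × (Var d →₀ ℕ)))
    {P : ι → MvPolynomial (Var d) (A d)} (hP : ∀ i ∈ s, JSupp (P i) ⊆ S) :
    JSupp (∑ i ∈ s, P i) ⊆ S := by
  refine (jsupp_sum s P).trans ?_
  intro x hx
  obtain ⟨i, hi, hx⟩ := Set.mem_iUnion₂.mp hx
  exact hP i hi hx

/-- Landing hook of part 3: the group law of the truncated action. -/
theorem stub_pm_action : ∀ (d T : ℕ) (R : Type) [CommRing R] [Algebra ℚ R] (c c' : Matrix (Fin d) (Fin d) R), (∀ i j : Fin d, j ≤ i → c i j = if i = j then 1 else 0) → (∀ i j : Fin d, j ≤ i → c' i j = if i = j then 1 else 0) → ∀ w : TruncModel d R T, piT T c (piT T c' w) = piT T (c * c') w :=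
  fun _ _ _ _ _ _ _ hc hc' w => piT_piT hc hc' w

end Summit.MatrixMultiplication.MatrixMultiplication.Theorems.UnitriangularCostShape.ProductModel
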